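import Mathlib.Data.Matrix.Block
import Mathlib.LinearAlgebra.Finsupp.Supported
import Literature.MathematicalPhysics.QuantumLattice.FermionOperatorsProofs
import Literature.NumberTheory.Automorphic.HarishChandraGLWeights
import HarnessLib

/-!
# A model of `𝔤𝔩ₙ(𝕜)_ℂ` with highest weight vectors of every weight and free lowering strings

Topic `Literature/NumberTheory/Automorphic` (support for `HarishChandraGL.lean`: the proof of the
named fact `Literature.NumberTheory.Automorphic.nonempty_harishChandraHomGL`, assembled in `HarishChandraGLExistence`).

Let `𝕜` be `ℝ` or `ℂ`, `T = (𝕜 →ₐ[ℝ] ℂ)`, `𝔤_ℂ = ∏_{τ ∈ T} 𝔤𝔩ₙ(ℂ)`. The proof of Harish-Chandra's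
theorem (Knapp, *Lie Groups Beyond an Introduction*, Thm. 5.44) uses, for every `λ ∈ 𝔥_ℂ^*`, a
module with a highest weight vector `v_λ` of weight `λ` on which the lowering operators act freely
(the Verma module `Z(λ)`, Humphreys §20.3 and §23.2, Knapp §V.3, whose construction rests on the
Poincaré–Birkhoff–Witt theorem). Mathlib has no PBW theorem; this file constructs instead ONE
explicit representation `Ψ` of `𝔤_ℂ` (a `HCWt.FactorRep`) containing, for every weight
`λ : T → Fin n → ℂ`, a highest weight vector `hwVec λ` of weight `λ` such that
`Ψ_τ(E_{i+1,i})^m (hwVec λ) ≠ 0` for all `τ`, `i` and all `m` (`pow_E_hwVec_ne_zero`). This is all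
the input the Harish-Chandra argument needs (`HarishChandraGLExistence`).

The construction ("complex powers of fermionic Fock coordinates"):

1. *One-particle space.* `U = ⨁_{τ ∈ T} ⨁_{q ∈ Fin 2} Λ(ℂⁿ)`, with basis
   `S = Finset (Fin n) × (Fin 2 × T)` (`T` replaced by its copy `Fin |T|` in `Type`, so that the
   model space lives in `Type`); `𝔤𝔩ₙ(ℂ)` acts on `Λ(ℂⁿ) = ⨁_I ℂ e_I` through the
   canonical anticommutation relations, `E_{jk} ↦ c†_j c_k`, using the Jordan–Wigner creation and
   annihilation matrices ALREADY IN THE TREE (`Literature.MathematicalPhysics.QuantumLattice.creation`, `Literature.MathematicalPhysics.QuantumLattice.annihilation`,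
   `Literature.MathematicalPhysics.QuantumLattice.jwSign` of `Literature.MathematicalPhysics.QuantumLattice.HubbardWave0`, with the
   CAR proved in `…QuantumLattice.FermionOperatorsProofs`: `annihilation_mul_creation`,
   `creation_mul_creation_eq_neg`, `annihilation_anticommute_holds`), and the `τ`-th factor of
   `𝔤_ℂ` acts on the summands indexed by `(q, τ)` (`blockEmb`).
2. *Polarisation.* For any finite set `S`, `𝔤𝔩(S) = Matrix S S ℂ` acts on the space
   `FormalMonomials S = (S → ℂ) →₀ ℂ` of formal monomials `X^A` (`A : S → ℂ`, complex
   exponents; the carrier of `AddMonoidAlgebra ℂ (S → ℂ)`, whose multiplication is not used) by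
   the polarisation operators `E_{s's} ↦ X_{s'} ∂_s`, `X^A ↦ A_s X^{A - e_s + e_{s'}}`
   (`pol`, `polRep`).
3. *Highest weight vectors.* For exponents `A` supported on the "initial segments"
   `(Iic r, (q, τ))`, `X^A` is a highest weight vector; its weight is
   `λ_{τ,j} = ∑_{r ≥ j} (A(Iic r, 0, τ) + A(Iic r, 1, τ))`, and every `λ` is obtained
   (`hwExp λ`: exponent `-1` on the copies `q = 0` and `λ_{τ,r} - λ_{τ,r+1} + 1` on `q = 1`).
4. *Free strings.* `F = Ψ_τ(E_{i+1,i})` moves one unit of exponent from `(Iic i, q, τ)` to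
   `(J, q, τ)`, `J = {0, …, i-1, i+1}`; following the copy `q = 0` (exponent `-1`, falling
   factorials `(-1)(-2)⋯(-m) ≠ 0`) modulo the `F`-stable subspace of monomials whose exponent at
   `(J, 1, τ)` is a positive integer shows `F^m (hwVec λ) ≠ 0`.

Relation to `HarishChandraGLProofs` and `HighestWeightGL` (in the tree). Those files realise
`𝔤𝔩ₙ(𝕜)` (resp. `𝔤𝔩ₙ(ℂ)^T`) on honest polynomials `ℂ[x_{pq}]` with highest weight vectors
`∏ Δ_S^{c_S}` (products of principal minors, natural exponents `c_S`), a Zariski dense set of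
highest weights — enough to pin `γ` down (uniqueness).
It cannot serve the existence proof: in a polynomial (locally finite) module the `𝔰𝔩₂`-string
through a highest weight vector `v` with `m = ⟨λ + ρ, α^∨⟩ ∈ ℕ` has length `m`, i.e.
`F_α^m v = 0`, whereas the `W`-symmetry step needs `F_α^m v ≠ 0` (in Humphreys' proof this is the
freeness of the Verma module over `U(𝔫⁻)`). The complex exponents below (in particular the
exponent `-1` on the copies `q = 0`) are exactly what makes the strings infinite.

Both Lie algebra homomorphisms (CAR and polarisation) are instances of `lieHomOfUnits`: elements
`e j k` of an associative algebra satisfying the `𝔤𝔩` commutation relations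
`[e_{jk}, e_{pq}] = δ_{kp} e_{jq} - δ_{qj} e_{pk}` define a Lie algebra homomorphism
`N ↦ ∑ N_{jk} e_{jk}` on `Matrix ι ι ℂ`.

## Main definitions

* `Literature.NumberTheory.Automorphic.HCModel.lieHomOfUnits`, `FormalMonomials`, `pol`, `polRep`, `carRep`
  (on `Literature.Hubbard.creation j * Literature.Hubbard.annihilation k`), `blockEmb`.
* `Literature.Automorphic.HCModel.ModelSpace 𝕜 n` — the model space;
  `Literature.Automorphic.HCModel.modelRep 𝕜 n` — the factorwise representation on it;
  `hwExp`, `hwVec` — the highest weight vectors.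

## Main statements

* `Literature.NumberTheory.Automorphic.HCModel.isHighestWeightVector_hwVec` — `hwVec λ` is a highest weight vector of
  weight `λ` for the real form `(modelRep 𝕜 n).rho`.
* `Literature.NumberTheory.Automorphic.HCModel.pow_E_hwVec_ne_zero` — `Ψ_τ(E_{i+1,i})^m (hwVec λ) ≠ 0`.

## References

* `Literature.MathematicalPhysics.QuantumLattice.HubbardWave0`, `…FermionOperatorsProofs` (this
  tree) — Jordan–Wigner creation/annihilation matrices and the CAR.
* A. W. Knapp, *Lie Groups Beyond an Introduction*, 2nd ed., Birkhäuser 2002, §V.3, §V.5.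
* J. E. Humphreys, *Introduction to Lie Algebras and Representation Theory*, GTM 9, Springer 1972,
  §20.3, §23.2.
-/

attribute [local instance 100] LieRing.ofAssociativeRing

open scoped Matrix

noncomputable section

namespace Literature.NumberTheory.Automorphic.HCModel

open HCWt Finsupp

/-! ### Lie algebra homomorphisms from `𝔤𝔩` commutation relations -/

section Units

variable {ι : Type*} [Fintype ι] [DecidableEq ι] {A : Type*} [Ring A] [Algebra ℂ A]

/-- The linear map `N ↦ ∑_{j,k} N_{jk} e_{jk}`. [folklore] -/
def linOfUnits (e : ι → ι → A) : Matrix ι ι ℂ →ₗ[ℂ] A where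
  toFun N := ∑ j, ∑ k, N j k • e j k
  map_add' N N' := by simp only [Matrix.add_apply, add_smul, Finset.sum_add_distrib]
  map_smul' c N := by simp only [Matrix.smul_apply, smul_eq_mul, mul_smul, RingHom.id_apply,
    Finset.smul_sum]

omit [DecidableEq ι] in
/-- Unfolding `linOfUnits`. [folklore] -/
theorem linOfUnits_apply (e : ι → ι → A) (N : Matrix ι ι ℂ) :
    linOfUnits e N = ∑ j, ∑ k, N j k • e j k := rfl

omit [DecidableEq ι] in
/-- The product of two images of `linOfUnits`, expanded. [folklore] -/
theorem linOfUnits_mul (e : ι → ι → A) (N N' : Matrix ι ι ℂ) :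
    linOfUnits e N * linOfUnits e N' =
      ∑ j, ∑ k, ∑ p, ∑ q, (N j k * N' p q) • (e j k * e p q) := by
  rw [linOfUnits_apply, linOfUnits_apply, Finset.sum_mul]
  refine Finset.sum_congr rfl fun j _ ↦ ?_
  rw [Finset.sum_mul]
  refine Finset.sum_congr rfl fun k _ ↦ ?_
  rw [Finset.mul_sum]
  refine Finset.sum_congr rfl fun p _ ↦ ?_
  rw [Finset.mul_sum]
  refine Finset.sum_congr rfl fun q _ ↦ ?_
  rw [smul_mul_smul_comm]

omit [DecidableEq ι] in
/-- The product in the other order, with the same summation indices. [folklore] -/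
theorem linOfUnits_mul' (e : ι → ι → A) (N N' : Matrix ι ι ℂ) :
    linOfUnits e N' * linOfUnits e N =
      ∑ j, ∑ k, ∑ p, ∑ q, (N j k * N' p q) • (e p q * e j k) := by
  rw [linOfUnits_mul]
  calc ∑ p, ∑ q, ∑ j, ∑ k, (N' p q * N j k) • (e p q * e j k)
      = ∑ p, ∑ j, ∑ q, ∑ k, (N' p q * N j k) • (e p q * e j k) :=
        Finset.sum_congr rfl fun _ _ ↦ Finset.sum_comm
    _ = ∑ j, ∑ p, ∑ q, ∑ k, (N' p q * N j k) • (e p q * e j k) := Finset.sum_comm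
    _ = ∑ j, ∑ p, ∑ k, ∑ q, (N' p q * N j k) • (e p q * e j k) :=
        Finset.sum_congr rfl fun _ _ ↦ Finset.sum_congr rfl fun _ _ ↦ Finset.sum_comm
    _ = ∑ j, ∑ k, ∑ p, ∑ q, (N' p q * N j k) • (e p q * e j k) :=
        Finset.sum_congr rfl fun _ _ ↦ Finset.sum_comm
    _ = ∑ j, ∑ k, ∑ p, ∑ q, (N j k * N' p q) • (e p q * e j k) := by
        simp only [mul_comm (N' _ _) (N _ _)]

/-- **Lie algebra homomorphisms from `𝔤𝔩` relations**: if elements `e j k` of an associative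
algebra satisfy `[e_{jk}, e_{pq}] = δ_{kp} e_{jq} - δ_{qj} e_{pk}`, then `N ↦ ∑ N_{jk} e_{jk}` is a
Lie algebra homomorphism `𝔤𝔩(ι, ℂ) → A`. Humphreys, GTM 9, §1.2 (relations of `𝔤𝔩ₙ`). [folklore] -/
def lieHomOfUnits (e : ι → ι → A)
    (he : ∀ j k p q, e j k * e p q - e p q * e j k =
      (if k = p then e j q else 0) - (if q = j then e p k else 0)) :
    Matrix ι ι ℂ →ₗ⁅ℂ⁆ A :=
  { linOfUnits e with
    map_lie' := by
      intro N N'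
      simp only [AddHom.toFun_eq_coe, LinearMap.coe_toAddHom]
      have hsub : ∀ (c : ι → ι → ι → ι → ℂ) (f g : ι → ι → ι → ι → A),
          ∑ j, ∑ k, ∑ p, ∑ q, c j k p q • f j k p q - ∑ j, ∑ k, ∑ p, ∑ q, c j k p q • g j k p q =
            ∑ j, ∑ k, ∑ p, ∑ q, c j k p q • (f j k p q - g j k p q) := by
        intro c f g
        simp only [smul_sub, Finset.sum_sub_distrib]
      have h1 : ∑ j, ∑ k, ∑ p, ∑ q, (N j k * N' p q) • (if k = p then e j q else 0) =
          linOfUnits e (N * N') := by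
        rw [linOfUnits_apply]
        refine Finset.sum_congr rfl fun j _ ↦ ?_
        calc ∑ k, ∑ p, ∑ q, (N j k * N' p q) • (if k = p then e j q else 0)
            = ∑ k, ∑ q, ∑ p, (N j k * N' p q) • (if k = p then e j q else 0) :=
              Finset.sum_congr rfl fun _ _ ↦ Finset.sum_comm
          _ = ∑ k, ∑ q, (N j k * N' k q) • e j q := by
              simp only [smul_ite, smul_zero, Finset.sum_ite_eq, Finset.mem_univ, if_true]
          _ = ∑ q, ∑ k, (N j k * N' k q) • e j q := Finset.sum_comm
          _ = ∑ q, (N * N') j q • e j q := by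
              simp only [Matrix.mul_apply, Finset.sum_smul]
      have h2 : ∑ j, ∑ k, ∑ p, ∑ q, (N j k * N' p q) • (if q = j then e p k else 0) =
          linOfUnits e (N' * N) := by
        rw [linOfUnits_apply]
        calc ∑ j, ∑ k, ∑ p, ∑ q, (N j k * N' p q) • (if q = j then e p k else 0)
            = ∑ j, ∑ k, ∑ p, (N j k * N' p j) • e p k := by
              simp only [smul_ite, smul_zero, Finset.sum_ite_eq', Finset.mem_univ, if_true]
          _ = ∑ j, ∑ p, ∑ k, (N j k * N' p j) • e p k :=
              Finset.sum_congr rfl fun _ _ ↦ Finset.sum_comm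
          _ = ∑ p, ∑ j, ∑ k, (N j k * N' p j) • e p k := Finset.sum_comm
          _ = ∑ p, ∑ k, ∑ j, (N j k * N' p j) • e p k :=
              Finset.sum_congr rfl fun _ _ ↦ Finset.sum_comm
          _ = ∑ p, ∑ k, (N' * N) p k • e p k := by
              simp only [Matrix.mul_apply, Finset.sum_smul, mul_comm (N _ _) (N' _ _)]
      rw [Ring.lie_def, Ring.lie_def, map_sub, linOfUnits_mul, linOfUnits_mul', hsub]
      simp only [he, smul_sub, Finset.sum_sub_distrib]
      rw [h1, h2] }

/-- Unfolding `lieHomOfUnits`. [folklore] -/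
theorem lieHomOfUnits_apply (e : ι → ι → A) (he) (N : Matrix ι ι ℂ) :
    lieHomOfUnits e he N = ∑ j, ∑ k, N j k • e j k := rfl

/-- `lieHomOfUnits` on a matrix unit. [folklore] -/
theorem lieHomOfUnits_single (e : ι → ι → A) (he) (j k : ι) (c : ℂ) :
    lieHomOfUnits e he (Matrix.single j k c) = c • e j k := by
  rw [lieHomOfUnits_apply, Finset.sum_eq_single j, Finset.sum_eq_single k]
  · rw [Matrix.single_apply, if_pos ⟨rfl, rfl⟩]
  · intro k' _ hk'
    rw [Matrix.single_apply, if_neg (fun h ↦ hk' h.2.symm), zero_smul]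
  · intro h; exact absurd (Finset.mem_univ k) h
  · intro j' _ hj'
    exact Finset.sum_eq_zero fun k' _ ↦ by
      rw [Matrix.single_apply, if_neg (fun h ↦ hj' h.1.symm), zero_smul]
  · intro h; exact absurd (Finset.mem_univ j) h

/-- A Lie algebra homomorphism into an associative algebra maps elements with vanishing bracket to
commuting elements. [folklore] -/
theorem map_mul_comm_of_lie_eq_zero {L : Type*} [LieRing L] [LieAlgebra ℂ L] (Φ : L →ₗ⁅ℂ⁆ A)
    {a b : L} (h : ⁅a, b⁆ = 0) : Φ a * Φ b = Φ b * Φ a := by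
  have key := LieHom.map_lie Φ a b
  rw [h, map_zero, LieRing.of_associative_ring_bracket] at key
  exact sub_eq_zero.mp key.symm

end Units

/-! ### Polarisation: `𝔤𝔩(S)` acting on formal monomials with complex exponents -/

section Polarisation

variable (S : Type*) [Fintype S] [DecidableEq S]

/-- The space of formal monomials `X^A = single A 1`, `A : S → ℂ` (complex exponents), with complex
coefficients. [folklore] -/
abbrev FormalMonomials : Type _ := (S → ℂ) →₀ ℂ

variable {S}

/-- The exponent vector `e_s` of the coordinate `X_s`. [folklore] -/
def uvec (s : S) : S → ℂ := Pi.single s 1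

omit [Fintype S] in
/-- `e_s(s) = 1`. [folklore] -/
@[simp] theorem uvec_apply_self (s : S) : uvec s s = 1 := by simp [uvec]

omit [Fintype S] in
/-- `e_s(t) = 0` for `t ≠ s`. [folklore] -/
theorem uvec_apply_of_ne {s t : S} (h : t ≠ s) : uvec s t = 0 := by simp [uvec, h]

omit [Fintype S] in
/-- `e_s(t) = δ_{st}`. [folklore] -/
theorem uvec_apply (s t : S) : uvec s t = if t = s then 1 else 0 := by simp [uvec, Pi.single_apply]

/-- The polarisation operator `X_{s'} ∂_s : X^A ↦ A_s X^{A - e_s + e_{s'}}`. [folklore] -/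
def pol (s' s : S) : FormalMonomials S →ₗ[ℂ] FormalMonomials S :=
  Finsupp.lsum ℂ fun A : S → ℂ ↦ A s • Finsupp.lsingle (A - uvec s + uvec s')

omit [Fintype S] in
/-- `pol` on a monomial. [folklore] -/
@[simp] theorem pol_single (s' s : S) (A : S → ℂ) (c : ℂ) :
    pol s' s (single A c) = A s • single (A - uvec s + uvec s') c := by
  simp [pol, Finsupp.lsum_single]

omit [Fintype S] in
/-- **Commutation relations of the polarisation operators**:
`[X_{s'}∂_s, X_{t'}∂_t] = δ_{st'} X_{s'}∂_t - δ_{ts'} X_{t'}∂_s`. [folklore] -/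
theorem pol_rel (s' s t' t : S) :
    pol s' s * pol t' t - pol t' t * pol s' s =
      (if s = t' then pol s' t else 0) - (if t = s' then pol t' s else 0) := by
  apply Finsupp.lhom_ext
  intro A c
  have huv : A t * uvec t s = A s * uvec s t := by
    by_cases h : s = t
    · subst h; rfl
    · rw [uvec_apply_of_ne h, uvec_apply_of_ne (Ne.symm h), mul_zero, mul_zero]
  have hX : A - uvec s + uvec s' - uvec t + uvec t' = A - uvec t + uvec t' - uvec s + uvec s' := by
    abel
  simp only [LinearMap.sub_apply, Module.End.mul_apply, pol_single, map_smul, smul_smul,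
    Pi.add_apply, Pi.sub_apply]
  rw [hX, ← sub_smul]
  rcases eq_or_ne s t' with rfl | h1 <;> rcases eq_or_ne t s' with rfl | h2
  · rw [if_pos rfl, if_pos rfl, uvec_apply_self, uvec_apply_self, pol_single,
      pol_single, show A - uvec t + uvec s - uvec s + uvec t = A by abel, sub_add_cancel,
      sub_add_cancel, ← sub_smul]
    congr 1
    linear_combination -huv
  · rw [if_pos rfl, if_neg h2, uvec_apply_self, uvec_apply_of_ne h2,
      LinearMap.zero_apply, sub_zero, pol_single, add_sub_cancel_right]
    congr 1
    linear_combination -huv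
  · rw [if_neg h1, if_pos rfl, uvec_apply_self, uvec_apply_of_ne h1,
      LinearMap.zero_apply, zero_sub, pol_single,
      show A - uvec t + uvec t' - uvec s + uvec t = A - uvec s + uvec t' by abel, ← neg_smul]
    congr 1
    linear_combination -huv
  · rw [if_neg h1, if_neg h2, uvec_apply_of_ne h1, uvec_apply_of_ne h2,
      LinearMap.zero_apply, sub_zero]
    convert zero_smul ℂ _
    linear_combination -huv

variable (S) in
/-- **The polarisation representation** of `𝔤𝔩(S) = Matrix S S ℂ` on formal monomials:
`N ↦ ∑_{s',s} N_{s's} X_{s'}∂_s`. [folklore] -/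
def polRep : Matrix S S ℂ →ₗ⁅ℂ⁆ Module.End ℂ (FormalMonomials S) :=
  lieHomOfUnits (fun s' s ↦ pol s' s) pol_rel

/-- The polarisation representation on a monomial. [folklore] -/
theorem polRep_single (N : Matrix S S ℂ) (A : S → ℂ) (c : ℂ) :
    polRep S N (single A c) = ∑ s', ∑ s, (N s' s * A s) • single (A - uvec s + uvec s') c := by
  rw [polRep, lieHomOfUnits_apply]
  simp only [LinearMap.sum_apply, LinearMap.smul_apply, pol_single, smul_smul]

/-- The polarisation representation of a *column-monomial* matrix (column `s` equal to
`a_s e_{φ s}` when `p s`, zero otherwise) on a monomial. [folklore] -/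
theorem polRep_single_of_col {N : Matrix S S ℂ} {p : S → Prop} [DecidablePred p] {φ : S → S}
    {a : S → ℂ} (hN : ∀ t s, N t s = if p s ∧ t = φ s then a s else 0) (A : S → ℂ) (c : ℂ) :
    polRep S N (single A c) =
      ∑ s, if p s then (a s * A s) • single (A - uvec s + uvec (φ s)) c else 0 := by
  rw [polRep_single, Finset.sum_comm]
  refine Finset.sum_congr rfl fun s _ ↦ ?_
  by_cases hp : p s
  · rw [if_pos hp, Finset.sum_eq_single (φ s)]
    · rw [hN, if_pos ⟨hp, rfl⟩]
    · intro t _ ht; rw [hN, if_neg (fun h ↦ ht h.2), zero_mul, zero_smul]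
    · intro h; exact absurd (Finset.mem_univ _) h
  · rw [if_neg hp]
    exact Finset.sum_eq_zero fun t _ ↦ by rw [hN, if_neg (fun h ↦ hp h.1), zero_mul, zero_smul]

end Polarisation

/-! ### The creation–annihilation representation of `𝔤𝔩ₙ(ℂ)` on `Λ(ℂⁿ)` -/

section CAR

open Literature.MathematicalPhysics.QuantumLattice

variable {n : ℕ}

/-- The `𝔤𝔩ₙ` relations for `e_{jk} = c†_j c_k` (Jordan–Wigner creation and annihilation
matrices of the tree, `Literature.MathematicalPhysics.QuantumLattice.creation` / `Literature.MathematicalPhysics.QuantumLattice.annihilation` of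
`Literature.MathematicalPhysics.QuantumLattice.HubbardWave0`, with the CAR proved in
`FermionOperatorsProofs`): `[c†_j c_k, c†_p c_q] = δ_{kp} c†_j c_q - δ_{qj} c†_p c_k`.
Humphreys §1.2; Essler et al. 2005, §2.2 (commutators of fermion bilinears). [folklore] -/
theorem creation_annihilation_rel (j k p q : Fin n) :
    creation j * annihilation k * (creation p * annihilation q) -
        creation p * annihilation q * (creation j * annihilation k) =
      (if k = p then creation j * annihilation q else 0) -
        (if q = j then creation p * annihilation k else 0) := by
  have hcc : creation j * creation p * (annihilation k * annihilation q) =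
      creation p * creation j * (annihilation q * annihilation k) := by
    rw [creation_mul_creation_eq_neg j p,
      eq_neg_of_add_eq_zero_left (annihilation_anticommute_holds (ι := Fin n) k q), neg_mul_neg]
  calc creation j * annihilation k * (creation p * annihilation q) -
        creation p * annihilation q * (creation j * annihilation k)
      = creation j * (annihilation k * creation p) * annihilation q -
          creation p * (annihilation q * creation j) * annihilation k := by
        noncomm_ring
    _ = creation j * ((if k = p then 1 else 0) - creation p * annihilation k) * annihilation q -
          creation p * ((if q = j then 1 else 0) - creation j * annihilation q) *
            annihilation k := by
        rw [annihilation_mul_creation, annihilation_mul_creation]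
    _ = (creation j * (if k = p then 1 else 0) * annihilation q -
            creation p * (if q = j then 1 else 0) * annihilation k) -
          (creation j * creation p * (annihilation k * annihilation q) -
            creation p * creation j * (annihilation q * annihilation k)) := by
        noncomm_ring
    _ = (if k = p then creation j * annihilation q else 0) -
          (if q = j then creation p * annihilation k else 0) := by
        rw [hcc, sub_self, sub_zero]
        by_cases hkp : k = p <;> by_cases hqj : q = j <;> simp [hkp, hqj]

/-- The **representation of `𝔤𝔩ₙ(ℂ)` on `Λ(ℂⁿ)`** by creation–annihilation operators,
`Y ↦ ∑_{j,k} Y_{jk} c†_j c_k` (the derivation extension of the standard representation; as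
matrices on the occupation basis `e_I`, `I ⊆ Fin n`, of `Literature.Hubbard.Fock (Fin n)`; the direct sum
of the exterior powers `Λ^p ℂⁿ` of the standard representation). [folklore] -/
def carRep : Matrix (Fin n) (Fin n) ℂ →ₗ⁅ℂ⁆ Matrix (Finset (Fin n)) (Finset (Fin n)) ℂ :=
  lieHomOfUnits (fun j k ↦ creation j * annihilation k) creation_annihilation_rel

/-- `carRep` on a matrix unit. [folklore] -/
theorem carRep_single (j k : Fin n) (c : ℂ) :
    carRep (Matrix.single j k c) = c • (creation j * annihilation k) :=
  lieHomOfUnits_single _ _ j k c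

/-- Entries of `c†_j c_k`: column `I` is `± e_{(I ∖ k) ∪ j}` when `k ∈ I` and `j ∉ I ∖ k`, and `0`
otherwise (signs `jwSign`). [folklore] -/
theorem creation_mul_annihilation_apply (j k : Fin n) (J I : Finset (Fin n)) :
    (creation j * annihilation k) J I =
      if (k ∈ I ∧ j ∉ I.erase k) ∧ J = insert j (I.erase k) then
        jwSign j (I.erase k) * jwSign k I else 0 := by
  rw [Matrix.mul_apply]
  by_cases hk : k ∈ I
  · rw [Finset.sum_eq_single (I.erase k)]
    · rw [annihilation_apply, if_pos ⟨Finset.notMem_erase k I, (Finset.insert_erase hk).symm⟩,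
        creation_apply, jwSign_erase_of_not_lt (lt_irrefl k), ite_mul, zero_mul]
      simp only [hk, true_and]
    · intro K _ hK
      rw [annihilation_apply, if_neg, mul_zero]
      rintro ⟨hkK, hI⟩
      exact hK (by rw [hI, Finset.erase_insert hkK])
    · intro h; exact absurd (Finset.mem_univ _) h
  · rw [if_neg (fun h ↦ hk h.1.1)]
    refine Finset.sum_eq_zero fun K _ ↦ ?_
    rw [annihilation_apply, if_neg, mul_zero]
    rintro ⟨-, hI⟩
    exact hk (hI ▸ Finset.mem_insert_self k K)

end CAR

/-! ### The model: `⨁_{τ, q} Λ(ℂⁿ)` polarised -/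

section Model

open Literature.MathematicalPhysics.QuantumLattice (jwSign creation annihilation jwSign_mul_self jwSign_ne_zero jwSign_erase_of_not_lt)

variable (𝕜 : Type*) [RCLike 𝕜] (n : ℕ)

/-- A copy in `Type` of the finite set `T = (𝕜 →ₐ[ℝ] ℂ)` of embeddings (so that the model space
lives in `Type`, as the axiom `HarishChandraHomGL.highestWeight` quantifies over `V : Type`).
[folklore] -/
abbrev EmbIdx : Type := Fin (Fintype.card (𝕜 →ₐ[ℝ] ℂ))

/-- The enumeration `T ≃ EmbIdx 𝕜` of the embeddings. [folklore] -/
def embIdx : (𝕜 →ₐ[ℝ] ℂ) ≃ EmbIdx 𝕜 := Fintype.equivFin _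

/-- Index of the copies of `Λ(ℂⁿ)` in the one-particle space: `q ∈ Fin 2` and (the number of)
`τ : 𝕜 →ₐ[ℝ] ℂ`. [folklore] -/
abbrev Copy : Type := Fin 2 × EmbIdx 𝕜

/-- The basis `S = {(I, q, τ)}` of the one-particle space `U = ⨁_{q,τ} Λ(ℂⁿ)`. [folklore] -/
abbrev OneParticle : Type := Finset (Fin n) × Copy 𝕜

/-- **The model space**: formal monomials with complex exponents in the coordinates of
`U = ⨁_{q,τ} Λ(ℂⁿ)`. [folklore] -/
abbrev ModelSpace : Type := FormalMonomials (OneParticle 𝕜 n)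

/-- The embedding of `𝔤𝔩(Λ ℂⁿ)` as the `τ`-th factor: block diagonal, equal to `Y` on the copies
`(q, τ)`, `q ∈ Fin 2`, and `0` on the other copies. Knapp, §VI.1. [folklore] -/
def blockEmb (τ : 𝕜 →ₐ[ℝ] ℂ) :
    Matrix (Finset (Fin n)) (Finset (Fin n)) ℂ →ₗ⁅ℂ⁆
      Matrix (OneParticle 𝕜 n) (OneParticle 𝕜 n) ℂ where
  toFun Y := Matrix.blockDiagonal fun o : Copy 𝕜 ↦ if o.2 = embIdx 𝕜 τ then Y else 0
  map_add' Y Z := by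
    rw [← Matrix.blockDiagonal_add]
    congr 1
    funext o
    simp only [Pi.add_apply]
    split_ifs <;> simp
  map_smul' c Y := by
    rw [RingHom.id_apply, ← Matrix.blockDiagonal_smul]
    congr 1
    funext o
    simp only [Pi.smul_apply]
    split_ifs <;> simp
  map_lie' {Y Z} := by
    rw [Ring.lie_def, Ring.lie_def, ← Matrix.blockDiagonal_mul, ← Matrix.blockDiagonal_mul,
      ← Matrix.blockDiagonal_sub]
    congr 1
    funext o
    simp only [Pi.sub_apply]
    split_ifs <;> simp

/-- Unfolding `blockEmb`. [folklore] -/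
theorem blockEmb_apply (τ : 𝕜 →ₐ[ℝ] ℂ) (Y : Matrix (Finset (Fin n)) (Finset (Fin n)) ℂ) :
    blockEmb 𝕜 n τ Y =
      Matrix.blockDiagonal fun o : Copy 𝕜 ↦ if o.2 = embIdx 𝕜 τ then Y else 0 := rfl

/-- Different factors have commuting block embeddings (indeed the products vanish). [folklore] -/
theorem blockEmb_mul_blockEmb {τ τ' : 𝕜 →ₐ[ℝ] ℂ} (h : τ ≠ τ')
    (Y Z : Matrix (Finset (Fin n)) (Finset (Fin n)) ℂ) :
    blockEmb 𝕜 n τ Y * blockEmb 𝕜 n τ' Z = 0 := by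
  rw [blockEmb_apply, blockEmb_apply, ← Matrix.blockDiagonal_mul, ← Matrix.blockDiagonal_zero]
  congr 1
  funext o
  simp only [Pi.zero_apply]
  split_ifs with h1 h2
  · exact absurd ((embIdx 𝕜).injective (h1.symm.trans h2)) h
  all_goals simp

/-- **The model representation** `Ψ` of `𝔤_ℂ = ∏_τ 𝔤𝔩ₙ(ℂ)`: the `τ`-th factor acts on the copies
`(q, τ)` of `Λ(ℂⁿ)` through creation–annihilation operators, polarised to formal monomials.
[folklore] -/
def modelRep : FactorRep 𝕜 n (ModelSpace 𝕜 n) where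
  toFun τ := (polRep (OneParticle 𝕜 n)).comp ((blockEmb 𝕜 n τ).comp carRep)
  commute τ τ' hne X Y := by
    refine map_mul_comm_of_lie_eq_zero (polRep (OneParticle 𝕜 n)) ?_
    rw [Ring.lie_def]
    show blockEmb 𝕜 n τ (carRep X) * blockEmb 𝕜 n τ' (carRep Y) -
      blockEmb 𝕜 n τ' (carRep Y) * blockEmb 𝕜 n τ (carRep X) = 0
    rw [blockEmb_mul_blockEmb 𝕜 n hne, blockEmb_mul_blockEmb 𝕜 n (Ne.symm hne), sub_zero]

/-- The matrix units of the model: `Ψ_τ(E_{jk})` is the polarisation of the block diagonal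
matrix `c_j a_k` on the copies `(q, τ)`. [folklore] -/
theorem modelRep_E (τ : 𝕜 →ₐ[ℝ] ℂ) (j k : Fin n) :
    (modelRep 𝕜 n).E τ j k = polRep (OneParticle 𝕜 n)
      (Matrix.blockDiagonal fun o : Copy 𝕜 ↦
        if o.2 = embIdx 𝕜 τ then creation j * annihilation k else 0) := by
  rw [FactorRep.E]
  show (polRep (OneParticle 𝕜 n)) (blockEmb 𝕜 n τ (carRep (Matrix.single j k 1))) = _
  rw [carRep_single, one_smul, blockEmb_apply]

/-- Entries of the block diagonal matrix `c_j a_k` (on the copies `(q, τ)`): column-monomial.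
[folklore] -/
theorem blockCar_apply (τ : 𝕜 →ₐ[ℝ] ℂ) (j k : Fin n) (t s : OneParticle 𝕜 n) :
    Matrix.blockDiagonal
        (fun o : Copy 𝕜 ↦ if o.2 = embIdx 𝕜 τ then creation j * annihilation k else 0) t s =
      if (s.2.2 = embIdx 𝕜 τ ∧ k ∈ s.1 ∧ j ∉ s.1.erase k) ∧ t = (insert j (s.1.erase k), s.2) then
        jwSign j (s.1.erase k) * jwSign k s.1 else 0 := by
  obtain ⟨J, o'⟩ := t
  obtain ⟨I, o⟩ := s
  rw [Matrix.blockDiagonal_apply]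
  by_cases hoo : o' = o
  · subst hoo
    rw [if_pos rfl]
    by_cases hτ : o'.2 = embIdx 𝕜 τ
    · rw [if_pos hτ, creation_mul_annihilation_apply]
      simp only [hτ, true_and, Prod.mk.injEq, and_true]
    · rw [if_neg hτ, Matrix.zero_apply, if_neg (fun h ↦ hτ h.1.1)]
  · rw [if_neg hoo, if_neg (fun h ↦ hoo (Prod.mk.inj h.2).2)]

/-- **Action of the matrix units on monomials** in the model:
`Ψ_τ(E_{jk}) X^A = ∑_{s = (I,q,τ), k ∈ I, j ∉ I∖k} ± A_s X^{A - e_s + e_{(I ∖ k ∪ j, q, τ)}}`.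
[folklore] -/
theorem E_single (τ : 𝕜 →ₐ[ℝ] ℂ) (j k : Fin n) (A : OneParticle 𝕜 n → ℂ) (c : ℂ) :
    (modelRep 𝕜 n).E τ j k (single A c) = ∑ s : OneParticle 𝕜 n,
      if s.2.2 = embIdx 𝕜 τ ∧ k ∈ s.1 ∧ j ∉ s.1.erase k then
        ((jwSign j (s.1.erase k) * jwSign k s.1) * A s) •
          single (A - uvec s + uvec (insert j (s.1.erase k), s.2)) c
      else 0 := by
  rw [modelRep_E]
  exact polRep_single_of_col
    (p := fun s : OneParticle 𝕜 n ↦ s.2.2 = embIdx 𝕜 τ ∧ k ∈ s.1 ∧ j ∉ s.1.erase k)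
    (φ := fun s ↦ (insert j (s.1.erase k), s.2))
    (a := fun s ↦ jwSign j (s.1.erase k) * jwSign k s.1)
    (blockCar_apply 𝕜 n τ j k) A c

variable {𝕜 n}

/-! ### Highest weight vectors of every weight -/

/-- `Iic` is injective on `Fin n`. [folklore] -/
theorem Iic_eq_Iic_iff {a b : Fin n} : Finset.Iic a = Finset.Iic b ↔ a = b := by
  refine ⟨fun h ↦ le_antisymm ?_ ?_, fun h ↦ by rw [h]⟩
  · exact Finset.mem_Iic.mp (h ▸ Finset.mem_Iic.mpr le_rfl)
  · exact Finset.mem_Iic.mp (h.symm ▸ Finset.mem_Iic.mpr le_rfl)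

/-- The next coordinate `l_{τ,r+1}` of a weight (`0` past the last coordinate). [folklore] -/
def lnext (l : ArchWeightGL 𝕜 n) (τ : 𝕜 →ₐ[ℝ] ℂ) (r : Fin n) : ℂ :=
  if h : (r : ℕ) + 1 < n then l τ ⟨r + 1, h⟩ else 0

/-- **Telescoping**: `∑_{r ≥ j} (l_{τ,r} - l_{τ,r+1}) = l_{τ,j}`. [folklore] -/
theorem sum_sub_lnext (l : ArchWeightGL 𝕜 n) (τ : 𝕜 →ₐ[ℝ] ℂ) (j : Fin n) :
    ∑ r : Fin n, (if j ≤ r then l τ r - lnext l τ r else 0) = l τ j := by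
  revert l j
  cases n with
  | zero => intro l j; exact j.elim0
  | succ n =>
    intro l j
    induction j using Fin.reverseInduction with
    | last =>
      rw [Finset.sum_eq_single (Fin.last n)]
      · rw [if_pos le_rfl, lnext, dif_neg (by simp), sub_zero]
      · intro r _ hr
        rw [if_neg (fun h ↦ hr (le_antisymm (Fin.le_last r) h))]
      · intro h; exact absurd (Finset.mem_univ _) h
    | cast j ih =>
      have hsplit : ∀ r : Fin (n + 1),
          (if j.castSucc ≤ r then l τ r - lnext l τ r else 0) =
            (if r = j.castSucc then l τ r - lnext l τ r else 0) +
              (if j.succ ≤ r then l τ r - lnext l τ r else 0) := by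
        intro r
        by_cases hr : r = j.castSucc
        · subst hr
          rw [if_pos le_rfl, if_pos rfl, if_neg (fun h ↦ ?_), add_zero]
          exact absurd (Fin.castSucc_lt_iff_succ_le.mpr h) (lt_irrefl _)
        · rw [if_neg hr, zero_add]
          by_cases h : j.castSucc ≤ r
          · rw [if_pos h, if_pos (Fin.castSucc_lt_iff_succ_le.mp (lt_of_le_of_ne h (Ne.symm hr)))]
          · rw [if_neg h, if_neg (fun h' ↦ h (le_of_lt (Fin.castSucc_lt_iff_succ_le.mpr h')))]
      rw [Finset.sum_congr rfl (fun r _ ↦ hsplit r), Finset.sum_add_distrib, ih, Finset.sum_ite_eq',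
        if_pos (Finset.mem_univ _)]
      have hnext : lnext l τ j.castSucc = l τ j.succ := by
        rw [lnext, dif_pos (by simp [j.isLt])]
        congr 1
      rw [hnext, sub_add_cancel]

/-- The exponent vector of the highest weight monomial of weight `l`: supported on the initial
segments `(Iic r, q, τ)`, with exponent `-1` on the copies `q = 0` and `l_{τ,r} - l_{τ,r+1} + 1`
on the copies `q = 1`. [folklore] -/
def hwExp (l : ArchWeightGL 𝕜 n) : OneParticle 𝕜 n → ℂ := fun s ↦
  ∑ r : Fin n, if s.1 = Finset.Iic r then
    (if s.2.1 = 0 then -1 else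
      l ((embIdx 𝕜).symm s.2.2) r - lnext l ((embIdx 𝕜).symm s.2.2) r + 1) else 0

/-- **The highest weight vector of weight `l`** of the model: the monomial `X^{hwExp l}`.
[folklore] -/
def hwVec (l : ArchWeightGL 𝕜 n) : ModelSpace 𝕜 n := single (hwExp l) 1

/-- `hwExp l` on an initial segment. [folklore] -/
theorem hwExp_Iic (l : ArchWeightGL 𝕜 n) (r : Fin n) (o : Copy 𝕜) :
    hwExp l (Finset.Iic r, o) = if o.1 = 0 then -1 else
      l ((embIdx 𝕜).symm o.2) r - lnext l ((embIdx 𝕜).symm o.2) r + 1 := by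
  simp only [hwExp, Iic_eq_Iic_iff, Finset.sum_ite_eq, Finset.mem_univ, if_true]

/-- `hwExp l` vanishes off the initial segments. [folklore] -/
theorem hwExp_of_ne (l : ArchWeightGL 𝕜 n) {s : OneParticle 𝕜 n} (h : ∀ r, s.1 ≠ Finset.Iic r) :
    hwExp l s = 0 :=
  Finset.sum_eq_zero fun r _ ↦ if_neg (h r)

/-- `hwVec l ≠ 0`. [folklore] -/
theorem hwVec_ne_zero (l : ArchWeightGL 𝕜 n) : hwVec l ≠ 0 := by
  rw [hwVec, Ne, Finsupp.single_eq_zero]; exact one_ne_zero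

/-- A raising matrix unit cannot act on an initial segment: if `k ∈ Iic r` and `j < k` then
`j ∈ (Iic r) ∖ k`. [folklore] -/
theorem not_raise_Iic {j k r : Fin n} (hjk : j < k) (hk : k ∈ Finset.Iic r) :
    j ∈ (Finset.Iic r).erase k :=
  Finset.mem_erase.mpr
    ⟨ne_of_lt hjk, Finset.mem_Iic.mpr ((le_of_lt hjk).trans (Finset.mem_Iic.mp hk))⟩

/-- Raising matrix units kill `hwVec l`. [folklore] -/
theorem E_hwVec_eq_zero (l : ArchWeightGL 𝕜 n) (τ : 𝕜 →ₐ[ℝ] ℂ) {j k : Fin n} (hjk : j < k) :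
    (modelRep 𝕜 n).E τ j k (hwVec l) = 0 := by
  rw [hwVec, E_single]
  refine Finset.sum_eq_zero fun s _ ↦ ?_
  split_ifs with h
  · rw [hwExp_of_ne l (fun r hr ↦ h.2.2 (hr ▸ not_raise_Iic hjk (hr ▸ h.2.1))), mul_zero, zero_smul]
  · rfl

/-- Sums over the one-particle basis of functions supported on initial segments. [folklore] -/
theorem sum_oneParticle_eq {M : Type*} [AddCommMonoid M] (f : OneParticle 𝕜 n → M)
    (hf : ∀ s, (∀ r, s.1 ≠ Finset.Iic r) → f s = 0) :
    ∑ s, f s = ∑ r : Fin n, ∑ o : Copy 𝕜, f (Finset.Iic r, o) := by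
  rw [Fintype.sum_prod_type]
  rw [← Finset.sum_subset (Finset.subset_univ (Finset.univ.image (Finset.Iic : Fin n → _)))]
  · rw [Finset.sum_image (fun a _ b _ h ↦ Iic_eq_Iic_iff.mp h)]
  · intro I _ hI
    refine Finset.sum_eq_zero fun o _ ↦ hf _ fun r hr ↦ hI ?_
    exact Finset.mem_image.mpr ⟨r, Finset.mem_univ _, hr.symm⟩

/-- **The weight of `hwVec l`**: `∑_{s = (I, q, τ), j ∈ I} (hwExp l)_s = l_{τ,j}`. [folklore] -/
theorem sum_hwExp (l : ArchWeightGL 𝕜 n) (τ : 𝕜 →ₐ[ℝ] ℂ) (j : Fin n) :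
    ∑ s : OneParticle 𝕜 n, (if s.2.2 = embIdx 𝕜 τ ∧ j ∈ s.1 then hwExp l s else 0) = l τ j := by
  rw [sum_oneParticle_eq]
  · rw [← sum_sub_lnext l τ j]
    refine Finset.sum_congr rfl fun r _ ↦ ?_
    rw [Fintype.sum_prod_type, Fin.sum_univ_two]
    simp only [hwExp_Iic, Finset.mem_Iic, ite_and, Finset.sum_ite_eq', Finset.mem_univ, if_true,
      Fin.one_eq_zero_iff, Equiv.symm_apply_apply]
    split_ifs <;> first | omega | ring
  · intro s hs
    rw [hwExp_of_ne l hs]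
    split_ifs <;> rfl

/-- Diagonal matrix units act on `hwVec l` by the weight `l`. [folklore] -/
theorem E_diag_hwVec (l : ArchWeightGL 𝕜 n) (τ : 𝕜 →ₐ[ℝ] ℂ) (j : Fin n) :
    (modelRep 𝕜 n).E τ j j (hwVec l) = l τ j • hwVec l := by
  rw [hwVec, E_single, ← sum_hwExp l τ j, Finset.sum_smul]
  refine Finset.sum_congr rfl fun s _ ↦ ?_
  by_cases h : s.2.2 = embIdx 𝕜 τ ∧ j ∈ s.1
  · have h' : s.2.2 = embIdx 𝕜 τ ∧ j ∈ s.1 ∧ j ∉ s.1.erase j :=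
      ⟨h.1, h.2, Finset.notMem_erase j s.1⟩
    rw [if_pos h', if_pos h, Finset.insert_erase h.2, jwSign_erase_of_not_lt (lt_irrefl j),
      jwSign_mul_self, one_mul,
      Prod.mk.eta, sub_add_cancel]
  · rw [if_neg (fun h' ↦ h ⟨h'.1, h'.2.1⟩), if_neg h, zero_smul]

/-- **`hwVec l` is a highest weight vector of weight `l`** for the real form of the model
representation. Knapp, §V.3 (existence of highest weight modules of every weight, here without
Verma modules). [folklore] -/
theorem isHighestWeightVector_hwVec (l : ArchWeightGL 𝕜 n) :
    IsHighestWeightVector (modelRep 𝕜 n).rho l (hwVec l) :=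
  (modelRep 𝕜 n).isHighestWeightVector_of (hwVec_ne_zero l)
    (fun τ _ _ hjk ↦ E_hwVec_eq_zero l τ hjk) (fun τ j ↦ E_diag_hwVec l τ j)

/-! ### Free lowering strings -/

section Strings

variable (l : ArchWeightGL 𝕜 n) (τ : 𝕜 →ₐ[ℝ] ℂ) {i i' : Fin n}

/-- The source indices `(Iic i, q, τ)` of the lowering operator `Ψ_τ(E_{i+1,i})` on `hwVec l`.
[folklore] -/
def srcIdx (τ : 𝕜 →ₐ[ℝ] ℂ) (i : Fin n) (q : Fin 2) : OneParticle 𝕜 n :=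
  (Finset.Iic i, (q, embIdx 𝕜 τ))

/-- The target set `J = {0, …, i-1, i'}` of the lowering operator. [folklore] -/
def tgtSet (i i' : Fin n) : Finset (Fin n) := insert i' ((Finset.Iic i).erase i)

/-- The target indices `(J, q, τ)`. [folklore] -/
def tgtIdx (τ : 𝕜 →ₐ[ℝ] ℂ) (i i' : Fin n) (q : Fin 2) : OneParticle 𝕜 n :=
  (tgtSet i i', (q, embIdx 𝕜 τ))

/-- `i ∉ J`. [folklore] -/
theorem not_mem_tgtSet (hi : (i' : ℕ) = i + 1) : i ∉ tgtSet i i' := by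
  simp only [tgtSet, Finset.mem_insert, Finset.mem_erase, ne_eq, not_true_eq_false, false_and,
    or_false]
  intro h; have := congrArg Fin.val h; omega

/-- `J` is not an initial segment. [folklore] -/
theorem tgtSet_ne_Iic (hi : (i' : ℕ) = i + 1) (r : Fin n) : tgtSet i i' ≠ Finset.Iic r := by
  intro h
  have h1 : i' ∈ Finset.Iic r := h ▸ Finset.mem_insert_self _ _
  have h2 : i ∈ Finset.Iic r := Finset.mem_Iic.mpr (le_trans (le_of_lt (show (i : ℕ) < i' by omega))
    (Finset.mem_Iic.mp h1))
  exact not_mem_tgtSet hi (h ▸ h2)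

/-- `i' ∉ (Iic i) ∖ i`. [folklore] -/
theorem not_mem_erase_Iic (hi : (i' : ℕ) = i + 1) : i' ∉ (Finset.Iic i).erase i := by
  simp only [Finset.mem_erase, Finset.mem_Iic, not_and, not_le]
  intro _; show (i : ℕ) < i'; omega

/-- Source and target indices differ. [folklore] -/
theorem srcIdx_ne_tgtIdx (hi : (i' : ℕ) = i + 1) (q q' : Fin 2) :
    srcIdx τ i q ≠ tgtIdx τ i i' q' := by
  intro h
  have h1 : Finset.Iic i = tgtSet i i' := congrArg Prod.fst h
  exact not_mem_tgtSet hi (h1 ▸ Finset.mem_Iic.mpr le_rfl)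

/-- `hwExp l` at the source indices. [folklore] -/
theorem hwExp_srcIdx (q : Fin 2) :
    hwExp l (srcIdx τ i q) = if q = 0 then -1 else l τ i - lnext l τ i + 1 := by
  rw [srcIdx, hwExp_Iic, Equiv.symm_apply_apply]

/-- `hwExp l` vanishes at the target indices. [folklore] -/
theorem hwExp_tgtIdx (hi : (i' : ℕ) = i + 1) (q : Fin 2) : hwExp l (tgtIdx τ i i' q) = 0 :=
  hwExp_of_ne l (tgtSet_ne_Iic hi)

/-- The set of exponent vectors whose exponent at `(J, 1, τ)` is a positive integer. [folklore] -/
def stabSet (τ : 𝕜 →ₐ[ℝ] ℂ) (i i' : Fin n) : Set (OneParticle 𝕜 n → ℂ) :=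
  {B | ∃ m : ℕ, B (tgtIdx τ i i' 1) = m + 1}

/-- The lowering operator maps monomials with exponents in `stabSet` into the span of such
monomials. [folklore] -/
theorem E_single_mem_supported (hi : (i' : ℕ) = i + 1) {B : OneParticle 𝕜 n → ℂ}
    (hB : B ∈ stabSet τ i i') (c : ℂ) :
    (modelRep 𝕜 n).E τ i' i (single B c) ∈ Finsupp.supported ℂ ℂ (stabSet τ i i') := by
  rw [E_single]
  refine Submodule.sum_mem _ fun s _ ↦ ?_
  split_ifs with h
  · refine Submodule.smul_mem _ _ (Finsupp.single_mem_supported ℂ c ?_)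
    obtain ⟨m, hm⟩ := hB
    have hs : tgtIdx τ i i' 1 ≠ s := fun hs ↦ not_mem_tgtSet hi (hs ▸ h.2.1 :)
    show ∃ m : ℕ, (B - uvec s + uvec (insert i' (s.1.erase i), s.2)) (tgtIdx τ i i' 1) = m + 1
    rw [Pi.add_apply, Pi.sub_apply, hm, uvec_apply_of_ne hs, sub_zero, uvec_apply]
    split_ifs
    · exact ⟨m + 1, by push_cast; ring⟩
    · exact ⟨m, by ring⟩
  · exact Submodule.zero_mem _

/-- **`F`-stability**: the span of the monomials with exponents in `stabSet` is stable under the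
lowering operator `F = Ψ_τ(E_{i+1,i})`. [folklore] -/
theorem E_mem_supported (hi : (i' : ℕ) = i + 1) {x : ModelSpace 𝕜 n}
    (hx : x ∈ Finsupp.supported ℂ ℂ (stabSet τ i i')) :
    (modelRep 𝕜 n).E τ i' i x ∈ Finsupp.supported ℂ ℂ (stabSet τ i i') := by
  have key : Finsupp.supported ℂ ℂ (stabSet τ i i') ≤
      (Finsupp.supported ℂ ℂ (stabSet τ i i')).comap ((modelRep 𝕜 n).E τ i' i) := by
    nth_rw 1 [Finsupp.supported_eq_span_single]
    rw [Submodule.span_le]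
    rintro _ ⟨B, hB, rfl⟩
    exact E_single_mem_supported τ hi hB 1
  exact key hx

/-- The exponent vectors `B_m = hwExp l + m (e_{(J,0,τ)} - e_{(Iic i,0,τ)})` reached from `hwExp l`
by following the copy `q = 0`. [folklore] -/
def bExp (l : ArchWeightGL 𝕜 n) (τ : 𝕜 →ₐ[ℝ] ℂ) (i i' : Fin n) (m : ℕ) : OneParticle 𝕜 n → ℂ :=
  hwExp l + (m : ℂ) • (uvec (tgtIdx τ i i' 0) - uvec (srcIdx τ i 0))

/-- `bExp` pointwise. [folklore] -/
theorem bExp_apply (m : ℕ) (s : OneParticle 𝕜 n) : bExp l τ i i' m s =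
    hwExp l s + m * (uvec (tgtIdx τ i i' 0) s - uvec (srcIdx τ i 0) s) := by
  simp [bExp]

/-- `bExp l τ i i' 0 = hwExp l`. [folklore] -/
theorem bExp_zero : bExp l τ i i' 0 = hwExp l := by
  simp [bExp]

/-- One more step along the copy `q = 0`. [folklore] -/
theorem bExp_succ (m : ℕ) :
    bExp l τ i i' m - uvec (srcIdx τ i 0) + uvec (tgtIdx τ i i' 0) = bExp l τ i i' (m + 1) := by
  simp only [bExp, Nat.cast_succ, add_smul, one_smul, smul_sub]
  abel

/-- The exponent of `B_m` at `(Iic i, 0, τ)` is `-1 - m` (never a natural number). [folklore] -/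
theorem bExp_srcIdx_zero (hi : (i' : ℕ) = i + 1) (m : ℕ) :
    bExp l τ i i' m (srcIdx τ i 0) = -1 - m := by
  rw [bExp_apply, hwExp_srcIdx, if_pos rfl, uvec_apply_self,
    uvec_apply_of_ne (srcIdx_ne_tgtIdx τ hi 0 0)]
  ring

/-- The exponent of `B_m` at `(J, 1, τ)` is `0`. [folklore] -/
theorem bExp_tgtIdx_one (hi : (i' : ℕ) = i + 1) (m : ℕ) :
    bExp l τ i i' m (tgtIdx τ i i' 1) = 0 := by
  rw [bExp_apply, hwExp_tgtIdx l τ hi, uvec_apply_of_ne (Ne.symm (srcIdx_ne_tgtIdx τ hi 0 1)),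
    uvec_apply_of_ne]
  · ring
  · simp [tgtIdx]

/-- `B_m` vanishes at every index where `F` can act, other than the two source indices.
[folklore] -/
theorem bExp_eq_zero_of (hi : (i' : ℕ) = i + 1) (m : ℕ) {s : OneParticle 𝕜 n}
    (hs : s.2.2 = embIdx 𝕜 τ ∧ i ∈ s.1 ∧ i' ∉ s.1.erase i) (h0 : s ≠ srcIdx τ i 0)
    (h1 : s ≠ srcIdx τ i 1) :
    bExp l τ i i' m s = 0 := by
  have hns : ∀ r, s.1 ≠ Finset.Iic r := by
    intro r hr
    have hir : i ≤ r := Finset.mem_Iic.mp (hr ▸ hs.2.1)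
    have hi'r : ¬(i' ≤ r) := fun h ↦ hs.2.2 (hr ▸ Finset.mem_erase.mpr
      ⟨fun h' ↦ by have := congrArg Fin.val h'; omega, Finset.mem_Iic.mpr h⟩)
    have hri : r = i := Fin.le_antisymm (by rw [Fin.le_def]; rw [Fin.le_def] at hi'r; omega) hir
    subst hri
    obtain ⟨I, q, τ'⟩ := s
    simp only at hr hs
    obtain ⟨rfl, -, -⟩ := hs
    subst hr
    fin_cases q
    · exact h0 rfl
    · exact h1 rfl
  have ht : s ≠ tgtIdx τ i i' 0 := fun h ↦ not_mem_tgtSet hi (h ▸ hs.2.1 :)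
  rw [bExp_apply, hwExp_of_ne l hns, uvec_apply_of_ne ht, uvec_apply_of_ne h0]
  ring

/-- The leading coefficient sign `±1` of the lowering operator at the source index. [folklore] -/
def aCoef (i i' : Fin n) : ℂ := jwSign i' ((Finset.Iic i).erase i) * jwSign i (Finset.Iic i)

/-- `aCoef i i' ≠ 0`. [folklore] -/
theorem aCoef_ne_zero (i i' : Fin n) : aCoef i i' ≠ 0 :=
  mul_ne_zero (jwSign_ne_zero _ _) (jwSign_ne_zero _ _)

/-- `srcIdx τ i 0 ≠ srcIdx τ i 1`. [folklore] -/
theorem srcIdx_zero_ne_one : srcIdx τ i 0 ≠ srcIdx τ i 1 := by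
  simp [srcIdx]

/-- **One lowering step**: `F X^{B_m} = aCoef · (-1 - m) X^{B_{m+1}} + y` with `y` in the `F`-stable
subspace. [folklore] -/
theorem E_single_bExp (hi : (i' : ℕ) = i + 1) (m : ℕ) :
    ∃ y ∈ Finsupp.supported ℂ ℂ (stabSet τ i i'),
      (modelRep 𝕜 n).E τ i' i (single (bExp l τ i i' m) 1) =
        (aCoef i i' * (-1 - m)) • single (bExp l τ i i' (m + 1)) 1 + y := by
  have hcond : ∀ q : Fin 2, (srcIdx τ i q).2.2 = embIdx 𝕜 τ ∧ i ∈ (srcIdx τ i q).1 ∧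
      i' ∉ (srcIdx τ i q).1.erase i :=
    fun q ↦ ⟨rfl, Finset.mem_Iic.mpr le_rfl, not_mem_erase_Iic hi⟩
  refine ⟨(aCoef i i' * bExp l τ i i' m (srcIdx τ i 1)) •
    single (bExp l τ i i' m - uvec (srcIdx τ i 1) + uvec (tgtIdx τ i i' 1)) 1, ?_, ?_⟩
  · refine Submodule.smul_mem _ _ (Finsupp.single_mem_supported ℂ (1 : ℂ) ⟨0, ?_⟩)
    rw [Pi.add_apply, Pi.sub_apply, bExp_tgtIdx_one l τ hi, uvec_apply_self,
      uvec_apply_of_ne (Ne.symm (srcIdx_ne_tgtIdx τ hi 1 1))]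
    push_cast; ring
  · rw [E_single, Finset.sum_eq_add_of_mem (srcIdx τ i 0) (srcIdx τ i 1) (Finset.mem_univ _)
      (Finset.mem_univ _) (srcIdx_zero_ne_one τ), if_pos (hcond 0), if_pos (hcond 1),
      bExp_srcIdx_zero l τ hi]
    · show (aCoef i i' * (-1 - m)) •
          single (bExp l τ i i' m - uvec (srcIdx τ i 0) + uvec (tgtIdx τ i i' 0)) 1 +
        (aCoef i i' * bExp l τ i i' m (srcIdx τ i 1)) •
          single (bExp l τ i i' m - uvec (srcIdx τ i 1) + uvec (tgtIdx τ i i' 1)) 1 = _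
      rw [bExp_succ]
    · intro s _ hs
      split_ifs with h
      · rw [bExp_eq_zero_of l τ hi m h hs.1 hs.2, mul_zero, zero_smul]
      · rfl

/-- The coefficient of `X^{B_m}` in `F^m (hwVec l)`: `∏_{r<m} aCoef · (-1 - r)`. [folklore] -/
def coef (i i' : Fin n) : ℕ → ℂ
  | 0 => 1
  | m + 1 => coef i i' m * (aCoef i i' * (-1 - m))

/-- `coef i i' m ≠ 0` (falling factorials of `-1` never vanish). [folklore] -/
theorem coef_ne_zero (i i' : Fin n) : ∀ m : ℕ, coef i i' m ≠ 0
  | 0 => one_ne_zero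
  | m + 1 => mul_ne_zero (coef_ne_zero i i' m) (mul_ne_zero (aCoef_ne_zero i i') (by
      rw [show (-1 - m : ℂ) = -(m + 1) by ring, neg_ne_zero]
      exact Nat.cast_add_one_ne_zero m))

/-- **Following the copy `q = 0`**: `F^m (hwVec l) ≡ coef m • X^{B_m}` modulo the `F`-stable
subspace. [folklore] -/
theorem pow_E_hwVec_sub_mem (hi : (i' : ℕ) = i + 1) : ∀ m : ℕ,
    ((modelRep 𝕜 n).E τ i' i ^ m) (hwVec l) - coef i i' m • single (bExp l τ i i' m) 1 ∈
      Finsupp.supported ℂ ℂ (stabSet τ i i')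
  | 0 => by
    rw [pow_zero, Module.End.one_apply, coef, one_smul, bExp_zero, hwVec, sub_self]
    exact Submodule.zero_mem _
  | m + 1 => by
    have ih := pow_E_hwVec_sub_mem hi m
    obtain ⟨y, hy, hEy⟩ := E_single_bExp l τ hi m
    have hv : ((modelRep 𝕜 n).E τ i' i ^ m) (hwVec l) = coef i i' m • single (bExp l τ i i' m) 1 +
        (((modelRep 𝕜 n).E τ i' i ^ m) (hwVec l) - coef i i' m • single (bExp l τ i i' m) 1) := by
      abel
    rw [pow_succ', Module.End.mul_apply, hv, map_add, map_smul, hEy]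
    have : coef i i' m • ((aCoef i i' * (-1 - m)) • single (bExp l τ i i' (m + 1)) 1 + y) +
        (modelRep 𝕜 n).E τ i' i (((modelRep 𝕜 n).E τ i' i ^ m) (hwVec l) -
          coef i i' m • single (bExp l τ i i' m) 1) -
        coef i i' (m + 1) • single (bExp l τ i i' (m + 1)) 1 =
        coef i i' m • y + (modelRep 𝕜 n).E τ i' i (((modelRep 𝕜 n).E τ i' i ^ m) (hwVec l) -
          coef i i' m • single (bExp l τ i i' m) 1) := by
      simp only [coef, smul_add, smul_smul]
      abel
    rw [this]
    exact Submodule.add_mem _ (Submodule.smul_mem _ _ hy) (E_mem_supported τ hi ih)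

/-- **Free lowering strings**: `Ψ_τ(E_{i+1,i})^m (hwVec l) ≠ 0` for every weight `l`, every factor
`τ`, every `i` and every `m`. This replaces the freeness of the Verma module `Z(λ)` over `U(𝔫⁻)`
(Humphreys, §20.3 and §23.2, via PBW; Knapp, §V.3) in the proof of Knapp's Thm. 5.44. [folklore] -/
theorem pow_E_hwVec_ne_zero (hi : (i' : ℕ) = i + 1) (m : ℕ) :
    ((modelRep 𝕜 n).E τ i' i ^ m) (hwVec l) ≠ 0 := by
  intro h0
  have hmem := pow_E_hwVec_sub_mem l τ hi m
  rw [h0, zero_sub, neg_mem_iff] at hmem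
  have hX : single (bExp l τ i i' m) (1 : ℂ) ∈ Finsupp.supported ℂ ℂ (stabSet τ i i') := by
    have := Submodule.smul_mem _ (coef i i' m)⁻¹ hmem
    rwa [smul_smul, inv_mul_cancel₀ (coef_ne_zero i i' m), one_smul] at this
  rw [Finsupp.mem_supported'] at hX
  by_cases hB : bExp l τ i i' m ∈ stabSet τ i i'
  · obtain ⟨m', hm'⟩ := hB
    rw [bExp_tgtIdx_one l τ hi] at hm'
    exact Nat.cast_add_one_ne_zero m' hm'.symm
  · exact one_ne_zero (Finsupp.single_eq_same.symm.trans (hX _ hB))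

end Strings

end Model

end Literature.NumberTheory.Automorphic.HCModel
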